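import Literature.Combinatorics.Sahi2008.ProvedCases

/-!
# `NoHeavyLowerTail` (crux stmt-CriticalPhenomena-4575), Sahi programme: **THE ONE-TERM THIRD-CUMULANT BOUND WITH A PRINCIPAL MIDDLE SLOT**
# `κ₃(A; ↑b, C) ≥ −μ(↑b)·Cov(A, C)` for up-sets `A, C` and a principal up-set `↑b` under every FKG weight (answer to prim-sahi-p2 gen 35, memo
# FROM-prim-sahi-p2-gen35-FIBRE-TRANSPORT §10 "p1/typer: … worth a two-line Lean lemma")

Support file (Sahi cell, seat `prim-sahi-p1`, generation 49; `--supports stmt-CriticalPhenomena-4575`).  Pure proofs, no definitions, no `sorry`,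
standard axioms.  Vocabulary: `mass`, `principalUp`, `fkg_upperSet_mass`, `fkg_upperSet_mass_principal` (`Literature/Probability/LatticeModels/
SahiThirdOrderCorrelation`).

THE MATHEMATICS.  With `a = μ(A)`, `β = μ(↑b)`, `γ = μ(C)` and the third central moment (= third joint cumulant)
`κ₃(A;B,C) = μ(ABC) − a·μ(BC) − β·μ(AC) − γ·μ(AB) + 2aβγ` (`B = ↑b`), p2's W-domination programme uses, on the percolation side, only the
two-term average bound `2κ₃ ≥ −(q_jCov(f,B_i) + q_iCov(f,B_j))`; on an FKG lattice with a PRINCIPAL middle slot the ONE-term bound holds: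
  `κ₃(A; ↑b, C) + μ(↑b)·Cov(A,C) = μ(A∩↑b∩C) − μ(A)μ(↑b∩C) − μ(C)μ(A∩↑b) + μ(A)μ(↑b)μ(C) ≥ Cov(A,↑b)·Cov(↑b,C)/μ(↑b) ≥ 0`,
because `μ(↑b)·[…] − Cov(A,↑b)Cov(↑b,C) = μ(↑b)μ(A∩↑b∩C) − μ(A∩↑b)μ(↑b∩C) ≥ 0` is Harris for `A, C` CONDITIONED on the principal up-set `↑b`
(Blinovsky's device).  `A` and `C` are arbitrary up-sets; only the middle slot is principal. [this work]
-/

namespace Summit.CriticalPhenomena.PercolationContinuityZ3.Theorems.SahiQuantC3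

open Finset Literature.Probability.LatticeModels
open scoped BigOperators

noncomputable section

variable {α : Type*} [DistribLattice α] [Fintype α] [DecidableEq α] [DecidableLE α]

/-- **Product form (no division):** `μ(↑b)·[μ(A∩↑b∩C) − μ(A)μ(↑b∩C) − μ(C)μ(A∩↑b) + μ(A)μ(↑b)μ(C)] ≥ Cov(A,↑b)·Cov(↑b,C) (≥ 0)` for up-sets `A, C`
under a nonnegative log-supermodular weight (no normalisation needed). [this work] -/
theorem kappa3_principal_mul_ge {μ : α → ℝ} (hμ₀ : 0 ≤ μ) (hμ : ∀ p q, μ p * μ q ≤ μ (p ⊓ q) * μ (p ⊔ q))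
    {A C : Finset α} (hA : IsUpperSet (A : Set α)) (hC : IsUpperSet (C : Set α)) (b : α) :
    (mass μ (A ∩ principalUp b) - mass μ A * mass μ (principalUp b)) * (mass μ (principalUp b ∩ C) - mass μ (principalUp b) * mass μ C) ≤
      mass μ (principalUp b) * (mass μ (A ∩ principalUp b ∩ C) - mass μ A * mass μ (principalUp b ∩ C) - mass μ C * mass μ (A ∩ principalUp b)
        + mass μ A * mass μ (principalUp b) * mass μ C) := by
  -- conditional Harris on `↑b`: μ(A∩↑b)·μ(C∩↑b) ≤ μ(↑b)·μ(A∩C∩↑b)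
  have hcond := fkg_upperSet_mass_principal hμ₀ hμ hA hC b
  have e1 : C ∩ principalUp b = principalUp b ∩ C := Finset.inter_comm _ _
  have e2 : A ∩ C ∩ principalUp b = A ∩ principalUp b ∩ C := Finset.inter_right_comm _ _ _
  rw [e1, e2] at hcond
  nlinarith [hcond]

/-- **THE ONE-TERM `κ₃` BOUND** (divided form): for up-sets `A, C`, any `b`, and a nonnegative log-supermodular weight of mass `1`,
`μ(A∩↑b∩C) − μ(A)μ(↑b∩C) − μ(C)μ(A∩↑b) + μ(A)μ(↑b)μ(C) ≥ 0`, i.e. `κ₃(A;↑b,C) ≥ −μ(↑b)·Cov(A,C)` with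
`κ₃ = μ(A∩↑b∩C) − μ(A)μ(↑b∩C) − μ(↑b)μ(A∩C) − μ(C)μ(A∩↑b) + 2μ(A)μ(↑b)μ(C)`. [this work] -/
theorem kappa3_principal_ge {μ : α → ℝ} (hμ₀ : 0 ≤ μ) (hμ : ∀ p q, μ p * μ q ≤ μ (p ⊓ q) * μ (p ⊔ q))
    (hZ : mass μ univ = 1) {A C : Finset α} (hA : IsUpperSet (A : Set α)) (hC : IsUpperSet (C : Set α)) (b : α) :
    0 ≤ mass μ (A ∩ principalUp b ∩ C) - mass μ A * mass μ (principalUp b ∩ C) - mass μ C * mass μ (A ∩ principalUp b)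
        + mass μ A * mass μ (principalUp b) * mass μ C := by
  have hB := isUpperSet_principalUp (α := α) b
  have key := kappa3_principal_mul_ge hμ₀ hμ hA hC b
  -- Harris: both covariance factors are nonnegative
  have h1 : mass μ A * mass μ (principalUp b) ≤ mass μ (A ∩ principalUp b) := by
    have h := fkg_upperSet_mass hμ₀ hμ hA hB
    rw [hZ, one_mul] at h; exact h
  have h2 : mass μ (principalUp b) * mass μ C ≤ mass μ (principalUp b ∩ C) := by
    have h := fkg_upperSet_mass hμ₀ hμ hB hC
    rw [hZ, one_mul] at h; exact h
  have hprod : 0 ≤ (mass μ (A ∩ principalUp b) - mass μ A * mass μ (principalUp b))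
      * (mass μ (principalUp b ∩ C) - mass μ (principalUp b) * mass μ C) := mul_nonneg (sub_nonneg.2 h1) (sub_nonneg.2 h2)
  have hβ := mass_nonneg hμ₀ (principalUp b)
  rcases hβ.eq_or_lt with h0 | hpos
  · -- degenerate: μ(↑b) = 0, so every mass inside ↑b vanishes
    have hz : ∀ S : Finset α, S ⊆ principalUp b → mass μ S = 0 := fun S hS =>
      le_antisymm (h0 ▸ mass_mono hμ₀ hS) (mass_nonneg hμ₀ S)
    rw [hz (A ∩ principalUp b ∩ C) (Finset.inter_subset_left.trans Finset.inter_subset_right),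
      hz (principalUp b ∩ C) Finset.inter_subset_left, hz (A ∩ principalUp b) Finset.inter_subset_right, ← h0]
    simp
  · nlinarith [key, hprod, hpos]

/-- **Cumulant form**: `κ₃(A; ↑b, C) ≥ −μ(↑b)·Cov(A, C)`. [this work] -/
theorem kappa3_principal_ge_neg_cov {μ : α → ℝ} (hμ₀ : 0 ≤ μ) (hμ : ∀ p q, μ p * μ q ≤ μ (p ⊓ q) * μ (p ⊔ q))
    (hZ : mass μ univ = 1) {A C : Finset α} (hA : IsUpperSet (A : Set α)) (hC : IsUpperSet (C : Set α)) (b : α) :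
    -(mass μ (principalUp b) * (mass μ (A ∩ C) - mass μ A * mass μ C)) ≤
      mass μ (A ∩ principalUp b ∩ C) - mass μ A * mass μ (principalUp b ∩ C) - mass μ (principalUp b) * mass μ (A ∩ C)
        - mass μ C * mass μ (A ∩ principalUp b) + 2 * (mass μ A * mass μ (principalUp b) * mass μ C) := by
  have h := kappa3_principal_ge hμ₀ hμ hZ hA hC b
  linarith

end

end Summit.CriticalPhenomena.PercolationContinuityZ3.Theorems.SahiQuantC3
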